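import Summits.QuantumFields.YangMills.Theses.ContractibleFibre

/-!
# `FibreContinuity` — negative lemma: the crux is not bookkeeping over its hypothesis

Refuter crux-attack on item stmt-QuantumFields-16242
(`Summit.QuantumFields.YangMills.Theses.ContractibleFibre.FibreContinuity`, route
`route-QuantumFields-ContractibleFibre`, rank 2). The crux has the shape
`∀ G … r, Anchor(Tube) → Uniform(Tube)` with

* `Anchor T := ∀ M, ∃ β₀ m₀, 0 < m₀ ∧ ∀ β ≥ β₀, ∀ w, ∃ C Lmin, T M β m₀ C w Lmin` (the fixed-width anchor,
  = the conclusion of `FibreAnchor`), and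
* `Uniform T := ∃ β₁, ∀ β ≥ β₁, ∃ m > 0, ∀ w, ∃ C, ∀ M, ∃ Lmin, T M β m C w Lmin` (one rate and
  width-uniform constants for every fibre width `M`),

where `T = Tube` is the inline free-tube clustering predicate. This file records, kernel-checked, that
the implication is NOT a matter of quantifier bookkeeping: for an abstract family `T` that is even
granted monotonicity in the coupling `β`, in the rate `m` (antitone), in the constant `C` and in the
volume floor `Lmin` — everything the registered skeleton `Cruxes/FibreContinuity/Lines/birth.lean`
uses of the tube body (`TubeClusters.mono`) and more — `Anchor T` does not imply `Uniform T`.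
Witness: `T M β … := (M : ℝ) ≤ β` (thresholds `β₀(M) = M` drifting to infinity with the width: every
fixed width is eventually "gapped", no coupling serves all widths). So any proof of the crux must open
the tube body, i.e. use the Wilson measure (where, by the abelian foil
`Literature.Barriers.QuantumFields.AbelianDeconfinementD4`, it must moreover be `G`-sensitive).

The converse direction IS bookkeeping (`uniformShape_anchorShape`): the uniform shape returns the
anchor shape with `β₀(M) := β₁` — the crux's conclusion dominates its hypothesis beyond `β₁`.

No statement of the route is asserted here (negative/support lane, `--supports stmt-QuantumFields-16242`);
the two shapes are written out inline (no auxiliary `def … : Prop`).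
-/

namespace Summit.QuantumFields.YangMills.Theorems.FibreContinuity.Negative

/-- **`FibreContinuity` is not bookkeeping.** Even for tube predicates `T M β m C w Lmin` monotone in
the coupling, antitone in the rate, monotone in the constant and in the volume floor, the anchor
shape (hypothesis prefix of the crux, verbatim) does not imply the uniform shape (conclusion prefix,
verbatim). Witness `T M β m C w Lmin := (M : ℝ) ≤ β`. -/
theorem anchorShape_not_implies_uniformShape :
    ¬ ∀ T : ℕ → ℝ → ℝ → ℝ → ℕ → ℕ → Prop,
      (∀ (M : ℕ) (β β' m m' C C' : ℝ) (w Lmin Lmin' : ℕ), T M β m C w Lmin →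
          β ≤ β' → m' ≤ m → C ≤ C' → Lmin ≤ Lmin' → T M β' m' C' w Lmin') →
      (∀ M : ℕ, ∃ β₀ m₀ : ℝ, 0 < m₀ ∧ ∀ β : ℝ, β₀ ≤ β → ∀ w : ℕ, ∃ C : ℝ, ∃ Lmin : ℕ,
          T M β m₀ C w Lmin) →
      ∃ β₁ : ℝ, ∀ β : ℝ, β₁ ≤ β → ∃ m : ℝ, 0 < m ∧ ∀ w : ℕ, ∃ C : ℝ, ∀ M : ℕ, ∃ Lmin : ℕ,
          T M β m C w Lmin := by
  intro h
  obtain ⟨β₁, hβ⟩ := h (fun M β _ _ _ _ => (M : ℝ) ≤ β)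
    (fun M β β' _ _ _ _ _ _ _ hT hb _ _ _ => le_trans hT hb)
    (fun M => ⟨M, 1, one_pos, fun β hb _ => ⟨0, 0, hb⟩⟩)
  obtain ⟨m, -, hm⟩ := hβ β₁ le_rfl
  obtain ⟨C, hC⟩ := hm 0
  obtain ⟨M, hM⟩ := exists_nat_gt β₁
  obtain ⟨Lmin, hL⟩ := hC M
  exact absurd hL (not_le.mpr hM)

/-- The converse is bookkeeping: the uniform shape gives the anchor shape (thresholds `β₀(M) := β₁`,
the rate read off at `β`; stated with the rate after `β`, which is all the anchor prefix needs here). -/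
theorem uniformShape_anchorShape (T : ℕ → ℝ → ℝ → ℝ → ℕ → ℕ → Prop)
    (h : ∃ β₁ : ℝ, ∀ β : ℝ, β₁ ≤ β → ∃ m : ℝ, 0 < m ∧ ∀ w : ℕ, ∃ C : ℝ, ∀ M : ℕ, ∃ Lmin : ℕ,
      T M β m C w Lmin) :
    ∀ M : ℕ, ∃ β₀ : ℝ, ∀ β : ℝ, β₀ ≤ β → ∃ m₀ : ℝ, 0 < m₀ ∧ ∀ w : ℕ, ∃ C : ℝ, ∃ Lmin : ℕ,
      T M β m₀ C w Lmin := by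
  obtain ⟨β₁, hβ⟩ := h
  intro M
  refine ⟨β₁, fun β hb => ?_⟩
  obtain ⟨m, hm, hw⟩ := hβ β hb
  refine ⟨m, hm, fun w => ?_⟩
  obtain ⟨C, hC⟩ := hw w
  obtain ⟨Lmin, hL⟩ := hC M
  exact ⟨C, Lmin, hL⟩

/-- Sanity: the route's crux is, definitionally, `∀ G … r, Anchor Tube → Uniform Tube` for its inline
`Tube` — a black-box `Anchor T → Uniform T` principle would prove it outright, and
`anchorShape_not_implies_uniformShape` says no such principle exists even for monotone `T`. -/
example (h : ∀ T : ℕ → ℝ → ℝ → ℝ → ℕ → ℕ → Prop,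
      (∀ M : ℕ, ∃ β₀ m₀ : ℝ, 0 < m₀ ∧ ∀ β : ℝ, β₀ ≤ β → ∀ w : ℕ, ∃ C : ℝ, ∃ Lmin : ℕ,
          T M β m₀ C w Lmin) →
      ∃ β₁ : ℝ, ∀ β : ℝ, β₁ ≤ β → ∃ m : ℝ, 0 < m ∧ ∀ w : ℕ, ∃ C : ℝ, ∀ M : ℕ, ∃ Lmin : ℕ,
          T M β m C w Lmin) :
    Summit.QuantumFields.YangMills.Theses.ContractibleFibre.FibreContinuity := by
  intro G _ _ _ _ _ r Tube hA
  exact h Tube hA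

end Summit.QuantumFields.YangMills.Theorems.FibreContinuity.Negative
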